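/- Free-seat work of EXTRA WIDTH SEAT `ym-line-cbag-p1-w4` (prover-ym-line-cbag-p1-w4-g2-0), route `EguchiKawaiDirectionLadder`
(ideator ym-idea-2, LINE 8), crux `TripleSmallBallMargin` (stmt-QuantumFields-27724): LEAD's request (F2/F3) — the compression split in the
label language carrying BOTH the linear far mass and `‖S‖_op ≤ 1` (over the LEAD's `exists_unitary_add_lowRank_add_small_opNorm`,
p643447), i.e. exactly the input of the LEAD's `blockPairFibre_le_min` (p644641).  ROUTE-INDEPENDENT.  Nothing here bears on the
Yang–Mills mass gap. -/
import Summits.QuantumFields.YangMills.Theorems.EguchiKawaiDirectionLadderCompressionSplitLabelsLinear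
import HarnessLib

/-!
# Route `EguchiKawaiDirectionLadder`: compression split in the label language, linear far mass and operator-norm bound

`compression_split_labels_opNorm` — for `X ∈ U(N)`, a labelling `ℓ : Fin N → Fin m`, a block `c` and a collar set `near`:
`X_{cc} = Θ + R + S`, `Θ` unitary, `rank R ≤ Σ_{a∈near}#{ℓ=a}`, `Σ|S|² ≤ Σ_{a≠c, a∉near} Σ|X_{ca}|²` AND `‖S‖_op ≤ 1`
(`0 ≤ D₂ ≤ 1` for the far defect, LEAD's `opNorm_le_one_of_posSemidef_le_one`).

HONEST FRAMING: linear algebra only.  The route bears on the barrier-ledger fact `EguchiKawaiBreakdown` only.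
-/

set_option autoImplicit false

noncomputable section

open NormedSpace
open scoped Matrix ComplexOrder MatrixOrder Matrix.Norms.L2Operator
open Literature.Barriers.QuantumFields

namespace Summit.QuantumFields.YangMills.Theorems.EguchiKawaiDirectionLadder

/-! ### Compression split in the label language with the operator-norm bound -/

section Labels

variable {N m : ℕ}

/-- **Compression split, LINEAR far mass AND `‖S‖_op ≤ 1` (S10-A / F3).**  For `X ∈ U(N)`, a labelling `ℓ`, a block `c` and a collar
set `near`: `X_{cc} = Θ + R + S`, `Θ` unitary, `rank R ≤ Σ_{a∈near}#{ℓ=a}`, `Σ|S|² ≤ Σ_{a ≠ c, a ∉ near} Σ|X_{ca}|²`, `‖S‖_op ≤ 1`. -/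
theorem compression_split_labels_opNorm (ℓ : Fin N → Fin m) (X : UN N) (c : Fin m) (near : Finset (Fin m)) :
    ∃ Θ R S : Matrix {i : Fin N // ℓ i = c} {i : Fin N // ℓ i = c} ℂ,
      Θ ∈ Matrix.unitaryGroup {i : Fin N // ℓ i = c} ℂ ∧
      R.rank ≤ ∑ a ∈ near, Fintype.card {i : Fin N // ℓ i = a} ∧
      ∑ i, ∑ j, ‖S i j‖ ^ 2 ≤ ∑ a ∈ (Finset.univ.erase c).filter (fun a => a ∉ near),
        ∑ i, ∑ j, ‖(X : Matrix (Fin N) (Fin N) ℂ).toBlock (fun i => ℓ i = c) (fun i => ℓ i = a) i j‖ ^ 2 ∧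
      ‖S‖ ≤ 1 ∧
      (X : Matrix (Fin N) (Fin N) ℂ).toBlock (fun i => ℓ i = c) (fun i => ℓ i = c) = Θ + R + S := by
  classical
  set O : Finset (Fin m) := Finset.univ.erase c with hO
  set G : Fin m → Matrix {i : Fin N // ℓ i = c} {i : Fin N // ℓ i = c} ℂ := fun a =>
    (X : Matrix (Fin N) (Fin N) ℂ).toBlock (fun i => ℓ i = c) (fun i => ℓ i = a) *
      ((X : Matrix (Fin N) (Fin N) ℂ).toBlock (fun i => ℓ i = c) (fun i => ℓ i = a))ᴴ with hG
  have hGpsd : ∀ a, (G a).PosSemidef := fun a => Matrix.posSemidef_self_mul_conjTranspose _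
  set D₁ := ∑ a ∈ O.filter (fun a => a ∈ near), G a with hD₁
  set D₂ := ∑ a ∈ O.filter (fun a => a ∉ near), G a with hD₂
  have hsplit : 1 - (X : Matrix (Fin N) (Fin N) ℂ).toBlock (fun i => ℓ i = c) (fun i => ℓ i = c) *
      ((X : Matrix (Fin N) (Fin N) ℂ).toBlock (fun i => ℓ i = c) (fun i => ℓ i = c))ᴴ = D₁ + D₂ := by
    rw [one_sub_compression_gram_eq_sum X ℓ c, hD₁, hD₂]
    exact (Finset.sum_filter_add_sum_filter_not O (fun a => a ∈ near) G).symm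
  -- `0 ≤ D₂ ≤ 1`
  have hD₂psd : D₂.PosSemidef := by
    rw [hD₂]
    exact Matrix.posSemidef_sum _ fun a _ => hGpsd a
  have h1D₂ : (1 - D₂).PosSemidef := by
    have h : 1 - D₂ = (X : Matrix (Fin N) (Fin N) ℂ).toBlock (fun i => ℓ i = c) (fun i => ℓ i = c) *
        ((X : Matrix (Fin N) (Fin N) ℂ).toBlock (fun i => ℓ i = c) (fun i => ℓ i = c))ᴴ + D₁ := by
      calc (1 : Matrix {i : Fin N // ℓ i = c} {i : Fin N // ℓ i = c} ℂ) - D₂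
          = (1 - (X : Matrix (Fin N) (Fin N) ℂ).toBlock (fun i => ℓ i = c) (fun i => ℓ i = c) *
              ((X : Matrix (Fin N) (Fin N) ℂ).toBlock (fun i => ℓ i = c) (fun i => ℓ i = c))ᴴ) +
            (X : Matrix (Fin N) (Fin N) ℂ).toBlock (fun i => ℓ i = c) (fun i => ℓ i = c) *
              ((X : Matrix (Fin N) (Fin N) ℂ).toBlock (fun i => ℓ i = c) (fun i => ℓ i = c))ᴴ - D₂ := by abel
        _ = (D₁ + D₂) + (X : Matrix (Fin N) (Fin N) ℂ).toBlock (fun i => ℓ i = c) (fun i => ℓ i = c) *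
              ((X : Matrix (Fin N) (Fin N) ℂ).toBlock (fun i => ℓ i = c) (fun i => ℓ i = c))ᴴ - D₂ := by rw [hsplit]
        _ = _ := by abel
    rw [h]
    refine (Matrix.posSemidef_self_mul_conjTranspose _).add ?_
    rw [hD₁]
    exact Matrix.posSemidef_sum _ fun a _ => hGpsd a
  obtain ⟨Θ, R, S, hΘ, hR, hS, hSop, hXeq⟩ := exists_unitary_add_lowRank_add_small_opNorm _ D₁ D₂ hsplit
  refine ⟨Θ, R, S, hΘ, hR.trans ?_, hS.trans ?_, hSop.trans (opNorm_le_one_of_posSemidef_le_one hD₂psd h1D₂), hXeq⟩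
  · calc D₁.rank ≤ ∑ a ∈ O.filter (fun a => a ∈ near), (G a).rank := rank_sum_le _ _
      _ ≤ ∑ a ∈ O.filter (fun a => a ∈ near), Fintype.card {i : Fin N // ℓ i = a} :=
          Finset.sum_le_sum fun a _ => rank_mul_conjTranspose_le_card _
      _ ≤ ∑ a ∈ near, Fintype.card {i : Fin N // ℓ i = a} :=
          Finset.sum_le_sum_of_subset fun a ha => (Finset.mem_filter.1 ha).2
  · have hle := sum_norm_sq_le_re_trace_of_posSemidef_le_one hD₂psd h1D₂
    have htr : (Matrix.trace D₂).re = ∑ a ∈ O.filter (fun a => a ∉ near),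
        ∑ i, ∑ j, ‖(X : Matrix (Fin N) (Fin N) ℂ).toBlock (fun i => ℓ i = c) (fun i => ℓ i = a) i j‖ ^ 2 := by
      rw [hD₂, Matrix.trace_sum, Complex.re_sum]
      refine Finset.sum_congr rfl fun a _ => ?_
      exact re_trace_mul_conjTranspose_eq_sum _
    rw [htr] at hle
    exact hle

end Labels

end Summit.QuantumFields.YangMills.Theorems.EguchiKawaiDirectionLadder

end
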